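import Literature.Computability.Complexity.HardcoreInapproximabilityGadget
import HarnessLib

/-!
# Towards Sly's Theorem 3.10: the `L²` core of the small subgraph conditioning method

Allan Sly, *Computational transition at the uniqueness threshold*, FOCS 2010 (arXiv:1005.5584), §3.2,
Theorem 3.6 (= Mossel–Weitz–Wormald 2009 Thm 7.1, after Janson 1995 / Wormald 1999).

`slyGadgetReduction_of_thm310` (`HardcoreInapproximabilityAssembly`) reduces Sly's gadget theorem to
the pointwise lower tail of Theorem 3.10, which Sly obtains from the small subgraph conditioning
method. This file records the method's deterministic core in the counting form used there (uniform
measure on a finite type of realisations):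

* `card_lowerTail_mul_sq_le_sum_sq` — for any control variate `W ≥ 1` and constant `c > a`,
  `#{Y ≤ a} (c - a)² ≤ Σ_ω (Y - cW)²`: a lower tail for `Y` follows from an `L²` approximation of `Y`
  by `cW`. In Janson's theorem `W = Π_i (1+δ_i)^{X_i}` with `X_i` the short cycle counts, and the
  hypotheses (cycle counts asymptotically Poisson(`λ_i`); `E[Y [X]_m]/EY → Π (λ_i(1+δ_i))^{m_i}`;
  `E Y²/(EY)² ≤ exp(Σ λ_i δ_i²) + o(1)`) say exactly that `Σ (Y - c*W)² = o(Σ Y²)`-small for the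
  optimal `c*` (`sum_sq_sub_optimal`), via the binomial expansion `one_add_pow_eq_sum_choose` which
  turns `E[Y W]` and `E[W²]` into finite sums of factorial moments.

The model-specific inputs (Sly's Lemmas 3.5, 3.7, 3.8) are not treated here.
[cite: Sly2010, Theorem 3.6, Lemma 3.9]
-/

namespace Literature.Computability.Complexity

open Finset

section SmallSubgraphCore

variable {Ω : Type*} [Fintype Ω]

/-- **Lower tail via a control variate** (the `L²` core of the small subgraph conditioning method):
if `W ≥ 1` pointwise and `c > t · avg Y`, then
`#{Y ≤ t · avg Y} · (c - t · avg Y)² ≤ Σ_ω (Y ω - c W ω)²`, i.e.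
`P(Y ≤ t EY) ≤ E[(Y - cW)²] / (c - t EY)²`. With `W = Π_i (1+δ_i)^{X_i}` (`X_i` the short cycle
counts) and `c ≈ EY e^{-Σ λ_i δ_i}`, the hypotheses of Janson's theorem make the right-hand side
`o((EY)²)`-small relative to `(c - tEY)² ≍ (EY)²`. [cite: Sly2010, Theorem 3.6 (after MWW09 Thm 7.1, Janson 1995)] -/
theorem card_lowerTail_mul_sq_le_sum_sq (Y W : Ω → ℝ) (hW : ∀ ω, 1 ≤ W ω) {c a : ℝ} (hc0 : 0 ≤ c)
    (hct : a < c) [DecidablePred fun ω => Y ω ≤ a] :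
    ((univ.filter fun ω => Y ω ≤ a).card : ℝ) * (c - a) ^ 2 ≤ ∑ ω, (Y ω - c * W ω) ^ 2 := by
  classical
  calc ((univ.filter fun ω => Y ω ≤ a).card : ℝ) * (c - a) ^ 2
      = ∑ _ω ∈ univ.filter (fun ω => Y ω ≤ a), (c - a) ^ 2 := by rw [Finset.sum_const, nsmul_eq_mul]
    _ ≤ ∑ ω ∈ univ.filter (fun ω => Y ω ≤ a), (Y ω - c * W ω) ^ 2 := by
        refine Finset.sum_le_sum fun ω hω => ?_
        have hY : Y ω ≤ a := (Finset.mem_filter.1 hω).2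
        -- `c W - Y ≥ c - a > 0`
        have h1 : c - a ≤ c * W ω - Y ω := by nlinarith [hW ω]
        have h2 : 0 ≤ c - a := by linarith
        calc (c - a) ^ 2 ≤ (c * W ω - Y ω) ^ 2 := pow_le_pow_left₀ h2 h1 2
          _ = (Y ω - c * W ω) ^ 2 := by ring
    _ ≤ ∑ ω, (Y ω - c * W ω) ^ 2 :=
        Finset.sum_le_sum_of_subset_of_nonneg (Finset.filter_subset _ _) fun ω _ _ => sq_nonneg _

/-- **The optimal control-variate constant**: with `c* = Σ YW / Σ W²`,
`Σ (Y - c* W)² = Σ Y² - (Σ YW)²/Σ W²`. [folklore] -/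
theorem sum_sq_sub_optimal (Y W : Ω → ℝ) (hW : 0 < ∑ ω, W ω ^ 2) :
    ∑ ω, (Y ω - (∑ ω', Y ω' * W ω') / (∑ ω', W ω' ^ 2) * W ω) ^ 2 =
      ∑ ω, Y ω ^ 2 - (∑ ω, Y ω * W ω) ^ 2 / ∑ ω, W ω ^ 2 := by
  set A := ∑ ω', Y ω' * W ω' with hA
  set B := ∑ ω', W ω' ^ 2 with hB
  have hB0 : B ≠ 0 := hW.ne'
  have hexp : ∀ ω, (Y ω - A / B * W ω) ^ 2 = Y ω ^ 2 - 2 * (A / B) * (Y ω * W ω) + (A / B) ^ 2 * W ω ^ 2 := fun ω => by ring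
  simp_rw [hexp]
  rw [Finset.sum_add_distrib, Finset.sum_sub_distrib, ← Finset.mul_sum, ← Finset.mul_sum, ← hA, ← hB]
  field_simp
  ring

/-- **Binomial expansion of the tilting weight**: `(1+δ)^x = Σ_{m ≤ x} C(x, m) δ^m` — so that
`E[Y (1+δ)^X] = Σ_m E[Y C(X,m)] δ^m` and `E[(1+δ)^{2X}] = Σ_m E[C(X,m)] ((1+δ)²-1)^m` are finite sums
of (falling-)factorial moments. [folklore] -/
theorem one_add_pow_eq_sum_choose (δ : ℝ) (x : ℕ) :
    (1 + δ) ^ x = ∑ m ∈ Finset.range (x + 1), (x.choose m : ℝ) * δ ^ m := by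
  rw [add_comm, add_pow]
  refine Finset.sum_congr rfl fun m _ => ?_
  rw [one_pow, mul_one, mul_comm]

end SmallSubgraphCore

end Literature.Computability.Complexity
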